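import Summits.ABC.IUTFork.Conditional.AbcOfSGenuineKWildInhabitedRow73
import Summits.ABC.IUTFork.Cor312GenuineKCyclotomicLowerBound
import Summits.ABC.IUTFork.Cor312GenuineKWildLowerBound
import HarnessLib

/-!
# R-W WINDOW-TABLE, W1 ROWS 6/7 UNCONDITIONAL — packages for the triple `73 + 2¹³·7⁷·941² = 3¹⁶·103³·127` at ANY level `l`:
# pole orders of `j(73/c)`, which primes carry bad fibre points, and the divisibilities of the unknown ramification index there

PROOF-ONLY file (D-0012; 0 definitions, 0 `Prop` facts) of the abc-iut cell — D-0079 RESCUE sub-cell R-W «WINDOW Θ-SIDE INEQUALITY», W1 ROW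
DECISIONS seat abc-iut-W-row-2 (gen 2); packages for the UNCONDITIONAL versions of rows 6/7 of HOME/plan/rescue/R-W/OPEN-10.md (sha16
1b0025ee7a8ba6d7): `pilotDataOfK:frey-73-5973865915867136-5973865915867209:73` and `…:127` (consumers: `AbcOfSGenuineKWildInhabitedRow73Unconditional.lean`,
`…Row73L127Unconditional.lean`). Pattern of abc-iut-W-row-1's `WRowFrey283Packages` §2–§3 / `WRowUnconditionalPackages` §2 (rows 1–4), over this seat's
gen-0 triple facts (`isABCTriple_frey73`, `eq_of_prime_dvd_triple_73`, `factorization_triple_73`, p476815) and abc-TRIPLE bridge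
(`Cor312Prov.natCast_dvd_of_placeOf_mem_S_triple`, p476012: a bad fibre point lies over a prime divisor of `abc`); the divisibilities are abc-iut-W-neg-1 /
W-neg-2's `GenuineK.thirty_mul_prime_dvd_absRamificationIdx_kOf_three_of_coprime` / `GenuineK.fifteen_mul_prime_dvd_absRamificationIdx_kOf_ratPoint_of_coprime` /
`…_mul_ratPoint`, consumed BY NAME. TAKES NO SIDE on [IUTchIII] Cor. 3.12 or on any author.

* `WRow.ord_jInv_frey73` — `ord_p j(73/c) = −2·v_p(abc)` at the places over `p ∈ {3, 7, 73, 103, 127, 941}` (`−32, −14, −2, −6, −2, −4`).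
* `WRow.bad_prime_frey73` — at ANY level `l`, a bad fibre point `x | p` of a genuine datum over `(ratPoint (73/c), l)` forces `p ≠ l`,
  `p ∈ {3, 7, 73, 103, 127, 941}` and the pole order above under `x`.
* `WRow.dvd_absRamificationIdx_frey73` — there: `30·l ∣ e(K_x/ℚ_3)` (`t = 16`), `15·l ∣ e` over `7, 73, 127, 941` (`t = 7, 1, 1, 2`, all prime to `15`),
  `15·l ∣ 3·e` over `103` (`t = 3`).
HONEST SCOPE: classical local/global number theory plus the cell's typed containers; nothing here bears on the printed inequality; typed ≠ proved
elsewhere; no abc claim. [cite: SilvermanAEC2009, Prop. III.1.7(b)] [cite: SilvermanATAEC1994, V.5 Thm. 5.3 and Cor. 5.4] [cite: Washington1997, Prop. 2.1]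
[cite: Mochizuki2012, IUTchI Def. 3.1 (b),(c) pp. 61–62, Rmk. 3.1.5 p. 65, Ex. 3.2 (iv) p. 71; IUTchIII Cor. 3.12 Step (xi-f) p. 184; IUTchIV Prop. 1.1 p. 9, Prop. 1.2 (i)(ii) p. 10, Prop. 1.4 (ii) p. 13, Cor. 2.2 (ii) proof (P5) p. 46] [claim: Mochizuki2012, status: disputed] for the IUT locutions only.
-/

noncomputable section

open Set Function Metric NumberField IsDedekindDomain

namespace Summit.ABC.IUTFork.Conditional

open Thm311 Thm311.Real Cor312 Cor312Vol Cor312Prov Literature.IUT.LogThetaLattice Literature.IUT.LogVolume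
  Literature.IUT.HodgeTheaters Literature.IUT.LogVolume.Cor22
open Literature.NumberTheory.NumberFields Literature.NumberTheory.GaloisRepresentations.Ultrametric
open Literature.NumberTheory.DiophantineGeometry Literature.NumberTheory.DiophantineGeometry.GenEll

/-! ## §1. Pole orders of `j(73/c)` -/

/-- **`ord_p j(73/c) = −2·v_p(abc)`** at the places of `ℚ` over `p ∈ {3, 7, 73, 103, 127, 941}` (Frey formula `j = 2⁸(cb+a²)³/(abc)²` + the
rational-point dictionary, `Cor22.ord_jInv_ratPoint_triple_eq`; `v_p(abc) = 16, 7, 1, 3, 1, 2`). [cite: SilvermanAEC2009, Prop. III.1.7(b)]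
[cite: MochizukiGenEll2010, Def. 3.3 p. 12] -/
theorem WRow.ord_jInv_frey73 (v : HeightOneSpectrum (𝓞 ℚ)) {p₀ : ℕ} (hv : Rat.HeightOneSpectrum.natGenerator v = p₀)
    (hp₀ : p₀ = 3 ∨ p₀ = 7 ∨ p₀ = 73 ∨ p₀ = 103 ∨ p₀ = 127 ∨ p₀ = 941) :
    ord ℚ v (jInv (((73 : ℕ) : ℚ) / (5973865915867209 : ℕ))) =
      -((if p₀ = 3 then 32 else if p₀ = 7 then 14 else if p₀ = 73 then 2 else if p₀ = 103 then 6 else if p₀ = 127 then 2 else 4 : ℕ) : ℤ) := by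
  obtain ⟨hf3, hf7, hf73, hf103, hf127, hf941⟩ := factorization_triple_73
  have h2 : Rat.HeightOneSpectrum.natGenerator v ≠ 2 := by
    rw [hv]; rcases hp₀ with h | h | h | h | h | h <;> omega
  have hd : Rat.HeightOneSpectrum.natGenerator v ∣ 73 * 5973865915867136 * 5973865915867209 := by
    rw [hv]; rcases hp₀ with rfl | rfl | rfl | rfl | rfl | rfl <;> norm_num
  rw [ord_jInv_ratPoint_triple_eq isABCTriple_frey73 v h2 hd, hv]
  rcases hp₀ with rfl | rfl | rfl | rfl | rfl | rfl
  · rw [hf3]; norm_num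
  · rw [hf7]; norm_num
  · rw [hf73]; norm_num
  · rw [hf103]; norm_num
  · rw [hf127]; norm_num
  · rw [hf941]; norm_num

/-! ## §2. Which primes carry the bad fibre points (any level `l`) -/

/-- **Which primes carry bad fibre points at `(ratPoint (73/c), l)`, and the pole order there**: a bad `x | p` lies over a prime divisor of
`abc = 73·(2¹³7⁷941²)·(3¹⁶103³127)` (`Cor312Prov.natCast_dvd_of_placeOf_mem_S_triple`: `j` is regular away from `abc`), `p ≠ 2, l`
(`ne_two_and_ne_l_of_placeOf_mem_S_pilotDataOfK`), so `p ∈ {3, 7, 73, 103, 127, 941} ∖ {l}` and `ord_p j(73/c) = −2·v_p(abc)` under `x`.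
[cite: Mochizuki2012, IUTchI Def. 3.1 (b),(c) pp. 61–62; IUTchIV Cor. 2.2 (ii) proof (P5) p. 46] [claim: Mochizuki2012, status: disputed] -/
theorem WRow.bad_prime_frey73 {l : ℕ} (T : Cor22.ThetaVolumeDatumAt (ratPoint (((73 : ℕ) : ℚ) / (5973865915867209 : ℕ))) l) (pp : Nat.Primes) :
    letI := T.instFieldF; letI := T.instNumberFieldF; letI := T.instAlgebraF; letI := T.instFieldK
    letI := T.instNumberFieldK; letI := T.instAlgebraK; letI := T.instFieldFbar; letI := T.instAlgebraFbar
    letI := T.instAlgebraKFbar; letI := T.instIsElliptic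
    haveI : Fact (pp : ℕ).Prime := ⟨pp.2⟩
    ∀ x : (thetaIndex (pilotDataOfK T.D T.K)).Fibre (.inr pp), placeOf (pilotDataOfK T.D T.K) pp.1 x ∈ (pilotDataOfK T.D T.K).S →
      (pp : ℕ) ≠ l ∧ (((pp : ℕ) = 3 ∧ ord ℚ (finBelow ℚ T.K (placeOf (pilotDataOfK T.D T.K) pp.1 x)) (jInv (((73 : ℕ) : ℚ) / (5973865915867209 : ℕ))) = -32) ∨
      ((pp : ℕ) = 7 ∧ ord ℚ (finBelow ℚ T.K (placeOf (pilotDataOfK T.D T.K) pp.1 x)) (jInv (((73 : ℕ) : ℚ) / (5973865915867209 : ℕ))) = -14) ∨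
      ((pp : ℕ) = 73 ∧ ord ℚ (finBelow ℚ T.K (placeOf (pilotDataOfK T.D T.K) pp.1 x)) (jInv (((73 : ℕ) : ℚ) / (5973865915867209 : ℕ))) = -2) ∨
      ((pp : ℕ) = 103 ∧ ord ℚ (finBelow ℚ T.K (placeOf (pilotDataOfK T.D T.K) pp.1 x)) (jInv (((73 : ℕ) : ℚ) / (5973865915867209 : ℕ))) = -6) ∨
      ((pp : ℕ) = 127 ∧ ord ℚ (finBelow ℚ T.K (placeOf (pilotDataOfK T.D T.K) pp.1 x)) (jInv (((73 : ℕ) : ℚ) / (5973865915867209 : ℕ))) = -2) ∨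
      ((pp : ℕ) = 941 ∧ ord ℚ (finBelow ℚ T.K (placeOf (pilotDataOfK T.D T.K) pp.1 x)) (jInv (((73 : ℕ) : ℚ) / (5973865915867209 : ℕ))) = -4)) := by
  letI := T.instFieldF; letI := T.instNumberFieldF; letI := T.instAlgebraF; letI := T.instFieldK
  letI := T.instNumberFieldK; letI := T.instAlgebraK; letI := T.instFieldFbar; letI := T.instAlgebraFbar
  letI := T.instAlgebraKFbar; letI := T.instIsElliptic
  haveI : Fact (pp : ℕ).Prime := ⟨pp.2⟩
  intro x hx
  have hjF : T.E.j = ((jInv (((73 : ℕ) : ℚ) / (5973865915867209 : ℕ)) : ℚ) : T.F) := by rw [T.j_eq]; exact eq_ratCast _ _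
  have hdvd := natCast_dvd_of_placeOf_mem_S_triple T.D isABCTriple_frey73 hjF pp x hx
  obtain ⟨h2, hl⟩ := ne_two_and_ne_l_of_placeOf_mem_S_pilotDataOfK T.D pp x hx
  have hgen := natGenerator_finBelow_placeOf T.D pp x
  refine ⟨hl, ?_⟩
  rcases eq_of_prime_dvd_triple_73 pp.2 hdvd with h | h | h | h | h | h | h
  · exact absurd h h2
  · exact Or.inl ⟨h, by rw [WRow.ord_jInv_frey73 _ hgen (Or.inl h), h]; norm_num⟩
  · exact Or.inr (Or.inl ⟨h, by rw [WRow.ord_jInv_frey73 _ hgen (Or.inr (Or.inl h)), h]; norm_num⟩)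
  · exact Or.inr (Or.inr (Or.inl ⟨h, by rw [WRow.ord_jInv_frey73 _ hgen (Or.inr (Or.inr (Or.inl h))), h]; norm_num⟩))
  · exact Or.inr (Or.inr (Or.inr (Or.inl ⟨h, by rw [WRow.ord_jInv_frey73 _ hgen (Or.inr (Or.inr (Or.inr (Or.inl h)))), h]; norm_num⟩)))
  · exact Or.inr (Or.inr (Or.inr (Or.inr (Or.inl ⟨h, by
      rw [WRow.ord_jInv_frey73 _ hgen (Or.inr (Or.inr (Or.inr (Or.inr (Or.inl h))))), h]; norm_num⟩))))
  · exact Or.inr (Or.inr (Or.inr (Or.inr (Or.inr ⟨h, by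
      rw [WRow.ord_jInv_frey73 _ hgen (Or.inr (Or.inr (Or.inr (Or.inr (Or.inr h))))), h]; norm_num⟩))))

/-! ## §3. Divisibilities of the ramification index at the bad fibre (any level `l`) -/

/-- **The triple `73 + 2¹³·7⁷·941² = 3¹⁶·103³·127`, any level `l`**: at a fibre point `x | p` of a genuine datum over `(ratPoint (73/c), l)` with
`p ≠ l`: `30·l ∣ e(K_x/ℚ_3)` (`t = 16`), `15·l ∣ e` over `7` (`t = 7`), `73` (`t = 1`), `127` (`t = 1`), `941` (`t = 2`), and `15·l ∣ 3·e` over `103`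
(`t = 3`) — abc-iut-W-neg-1 / W-neg-2's lower bounds (`…_three_of_coprime`, `fifteen_mul_prime_dvd_…_ratPoint_of_coprime`, `…_mul_ratPoint`) at the
pole orders `ord_p j = −2·v_p(abc)` of `WRow.ord_jInv_frey73`. [cite: SilvermanATAEC1994, V.5 Thm. 5.3 and Cor. 5.4] [cite: Washington1997, Prop. 2.1]
[claim: Mochizuki2012, status: disputed] -/
theorem WRow.dvd_absRamificationIdx_frey73 {l : ℕ} (T : Cor22.ThetaVolumeDatumAt (ratPoint (((73 : ℕ) : ℚ) / (5973865915867209 : ℕ))) l)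
    (pp : Nat.Primes) (hpl : (pp : ℕ) ≠ l) :
    letI := T.instFieldF; letI := T.instNumberFieldF; letI := T.instAlgebraF; letI := T.instFieldK
    letI := T.instNumberFieldK; letI := T.instAlgebraK; letI := T.instFieldFbar; letI := T.instAlgebraFbar
    letI := T.instAlgebraKFbar; letI := T.instIsElliptic
    haveI : Fact (pp : ℕ).Prime := ⟨pp.2⟩
    ∀ x : (thetaIndex (pilotDataOfK T.D T.K)).Fibre (.inr pp),
      ((pp : ℕ) = 3 → 30 * l ∣ absRamificationIdx (pp : ℕ) (kOf (pilotDataOfK T.D T.K) pp.1 x)) ∧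
      ((pp : ℕ) = 7 → 15 * l ∣ absRamificationIdx (pp : ℕ) (kOf (pilotDataOfK T.D T.K) pp.1 x)) ∧
      ((pp : ℕ) = 73 → 15 * l ∣ absRamificationIdx (pp : ℕ) (kOf (pilotDataOfK T.D T.K) pp.1 x)) ∧
      ((pp : ℕ) = 103 → 15 * l ∣ absRamificationIdx (pp : ℕ) (kOf (pilotDataOfK T.D T.K) pp.1 x) * 3) ∧
      ((pp : ℕ) = 127 → 15 * l ∣ absRamificationIdx (pp : ℕ) (kOf (pilotDataOfK T.D T.K) pp.1 x)) ∧
      ((pp : ℕ) = 941 → 15 * l ∣ absRamificationIdx (pp : ℕ) (kOf (pilotDataOfK T.D T.K) pp.1 x)) := by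
  letI := T.instFieldF; letI := T.instNumberFieldF; letI := T.instAlgebraF; letI := T.instFieldK
  letI := T.instNumberFieldK; letI := T.instAlgebraK; letI := T.instFieldFbar; letI := T.instAlgebraFbar
  letI := T.instAlgebraKFbar; letI := T.instIsElliptic
  haveI : Fact (pp : ℕ).Prime := ⟨pp.2⟩
  intro x
  have hpole : ∀ {p₀ : ℕ} (t : ℕ), (p₀ = 3 ∧ t = 16) ∨ (p₀ = 7 ∧ t = 7) ∨ (p₀ = 73 ∧ t = 1) ∨ (p₀ = 103 ∧ t = 3) ∨ (p₀ = 127 ∧ t = 1) ∨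
      (p₀ = 941 ∧ t = 2) →
      ∀ v : HeightOneSpectrum (𝓞 ℚ), Rat.HeightOneSpectrum.natGenerator v = p₀ → ord ℚ v (jInv (((73 : ℕ) : ℚ) / (5973865915867209 : ℕ))) = -(2 * (t : ℤ)) := by
    intro p₀ t ht v hv
    have hp₀ : p₀ = 3 ∨ p₀ = 7 ∨ p₀ = 73 ∨ p₀ = 103 ∨ p₀ = 127 ∨ p₀ = 941 := by
      rcases ht with h | h | h | h | h | h <;> simp [h.1]
    rw [WRow.ord_jInv_frey73 v hv hp₀]
    rcases ht with ⟨rfl, rfl⟩ | ⟨rfl, rfl⟩ | ⟨rfl, rfl⟩ | ⟨rfl, rfl⟩ | ⟨rfl, rfl⟩ | ⟨rfl, rfl⟩ <;> norm_num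
  refine ⟨fun hp => ?_, fun hp => ?_, fun hp => ?_, fun hp => ?_, fun hp => ?_, fun hp => ?_⟩
  · have hpp : pp = ⟨3, Nat.prime_three⟩ := Subtype.ext hp
    subst hpp
    exact GenuineK.thirty_mul_prime_dvd_absRamificationIdx_kOf_three_of_coprime T (fun h => hpl h.symm) (t := 16) (by norm_num)
      (by decide) (hpole 16 (Or.inl ⟨rfl, rfl⟩)) x
  · exact GenuineK.fifteen_mul_prime_dvd_absRamificationIdx_kOf_ratPoint_of_coprime T pp (by rw [hp]; norm_num) hpl (t := 7)
      (by norm_num) (by decide) (fun v hv => hpole 7 (Or.inr (Or.inl ⟨hp, rfl⟩)) v hv) x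
  · exact GenuineK.fifteen_mul_prime_dvd_absRamificationIdx_kOf_ratPoint_of_coprime T pp (by rw [hp]; norm_num) hpl (t := 1)
      (by norm_num) (by decide) (fun v hv => hpole 1 (Or.inr (Or.inr (Or.inl ⟨hp, rfl⟩))) v hv) x
  · exact GenuineK.fifteen_mul_prime_dvd_absRamificationIdx_kOf_mul_ratPoint T pp (by rw [hp]; norm_num) hpl (t := 3)
      (by norm_num) (fun v hv => hpole 3 (Or.inr (Or.inr (Or.inr (Or.inl ⟨hp, rfl⟩)))) v hv) x
  · exact GenuineK.fifteen_mul_prime_dvd_absRamificationIdx_kOf_ratPoint_of_coprime T pp (by rw [hp]; norm_num) hpl (t := 1)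
      (by norm_num) (by decide) (fun v hv => hpole 1 (Or.inr (Or.inr (Or.inr (Or.inr (Or.inl ⟨hp, rfl⟩))))) v hv) x
  · exact GenuineK.fifteen_mul_prime_dvd_absRamificationIdx_kOf_ratPoint_of_coprime T pp (by rw [hp]; norm_num) hpl (t := 2)
      (by norm_num) (by decide) (fun v hv => hpole 2 (Or.inr (Or.inr (Or.inr (Or.inr (Or.inr ⟨hp, rfl⟩))))) v hv) x

end Summit.ABC.IUTFork.Conditional

end
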